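import Literature.NumberTheory.PAdicHodge.LegendreRelationOfWeil
import Literature.NumberTheory.PAdicHodge.WeilPairingPeriodExtension
import Literature.NumberTheory.PAdicHodge.BdRPeriodDeterminantOfWeil
import Literature.NumberTheory.PAdicHodge.DeRhamOfPeriodHoms
import Mathlib.RingTheory.TensorProduct.Free
import HarnessLib

/-!
# The Legendre relation of two period maps on `T_pW` up to `F^×`: `Pω(S)Pη(U) − Pη(S)Pω(U) = ι_F(c) · ι(e_∞(S,U))`

Topic `Literature/NumberTheory/PAdicHodge`; THEOREMS ONLY (no definition, no named fact, no instance, no `sorry`). Assembly of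
`BdRPeriodDeterminantOfWeil.exists_det_eq_algebraMap_mul_tFrac` (the period determinant of `V_pW|_{Γ_F}` on a basis is `c · t`, `c ∈ F^×`,
from Fontaine's regularity and `det ρ = χ`) with `LegendreRelationOfWeil.exists_legendre_of_basis_values` (alternating forms on the rank-two
free `ℤ_p`-module `T_pW` are determined by one value):

★★ `exists_legendre_of_periodHoms` — for `Γ_F`-equivariant `ℤ_p`-homogeneous `Pω, Pη : T_pW → B_dR⁺(F)` with `Pω ⊆ Fil¹`, `Pω ≢ 0`,
`Pη ⊄ Fil¹`, and an alternating Weil tower `e_∞` non-degenerate on `T_pW`, **there is `c ∈ F^×` with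
`Pω(S)Pη(U) − Pη(S)Pω(U) = ι_F(c) · ι(e_∞(S,U))` for all `S, U ∈ T_pW`** — the hypothesis `hLeg` of `TatePairingCochainLegendre` /
`RecognitionFromTeichLog` after replacing `Pη` by `c⁻¹ Pη`. [Colmez: for the Néron `ω, η` and the genuine Weil pairing `c = ±1`.]

Line `kato_lever` of crux K★ `stmt-BirchSwinnertonDyer-22226`; BSD / K★ / [REC] are NOT proved by any of this.

## References
* P. Colmez, Math. Ann. 292 (1992), §2. [Colmez1992PeriodesAbeliennes]
* J.-M. Fontaine, Invent. Math. 65 (1982), §5. [Fontaine1982FormesDifferentielles]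
* J. Tate, *p-divisible groups* (1967), §4. [Tate1967]
* J. H. Silverman, *AEC* (2009), Prop. III.8.1, III.8.3. [SilvermanAEC2009]
-/

noncomputable section

open Field Function ValuativeRel WittVector
open scoped TensorProduct

namespace Literature.NumberTheory.PAdicHodge

open Literature.NumberTheory.GaloisRepresentations
open Literature.NumberTheory.GaloisRepresentations.IsNonarchimedeanLocalField
open Literature.NumberTheory.GaloisCohomology
open Literature.NumberTheory.EllipticCurves
open _root_.WeierstrassCurve

namespace BdRPlusTop

variable {F : Type} [Field F] [ValuativeRel F] [TopologicalSpace F] [IsNonarchimedeanLocalField F] [CharZero F]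
  {p : ℕ} [Fact p.Prime] [Fact (¬ IsUnit (p : integerC F))] [IsAdicComplete (Ideal.span {(p : integerC F)}) (integerC F)]
  (hp : valuation F p < 1) (hF : Function.Surjective (fontaineTheta (integerC F) p))
  {K₀ : Type} [Field K₀] [CharZero K₀] [Algebra K₀ F] (W : WeierstrassCurve K₀) [W.IsElliptic]
  (e : (k : ℕ) → geomTorsion W ((p ^ k : ℕ) : ℤ) → geomTorsion W ((p ^ k : ℕ) : ℤ) → AlgebraicClosure K₀)
  (hμ : ∀ k S T, e k S T ^ (p ^ k) = 1) (hadd₁ : ∀ k S₁ S₂ T, e k (S₁ + S₂) T = e k S₁ T * e k S₂ T)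
  (hadd₂ : ∀ k S T₁ T₂, e k S (T₁ + T₂) = e k S T₁ * e k S T₂)
  (hgal : ∀ k (σ : absoluteGaloisGroup K₀) (S T : geomTorsion W ((p ^ k : ℕ) : ℤ)), σ • e k S T = e k (σ • S) (σ • T))
  (hcompat : ∀ k (S T : geomTorsion W ((p ^ (k + 1) : ℕ) : ℤ)),
    e k (torsionMulHom W (p ^ (k + 1)) (p ^ k) p (pow_succ p k).symm S)
      (torsionMulHom W (p ^ (k + 1)) (p ^ k) p (pow_succ p k).symm T) = e (k + 1) S T ^ p)

include hF in
/-- `x ∈ Fil¹ B_dR⁺` read in `B_dR`: `j(x) ∈ Fil¹`. [cite: FontaineAsterisque223III, Exp. II §1.5.5] -/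
theorem bdRPlusToFrac_mem_fil_one_of_mem_filOne [Algebra ℚ_[p] F] {x : BdRPlusTop F p} (hx : x ∈ (filOne F p).toIdeal) :
    bdRPlusToFrac hp ((of F p).symm x) ∈ (bdRPeriodRingData (F := F) (p := p) hp).fil 1 := by
  haveI : IsDomain (BDeRhamPlus (integerC F) p) := isDomain_bDeRhamPlus hF
  obtain ⟨b, hb⟩ := Ideal.mem_span_singleton'.1 ((mem_filOne_iff).1 hx)
  refine (mem_fil_iff hp (surjective_fontaineTheta_integerC hp)).2 ⟨b, ?_⟩
  rw [← hb, zpow_one, map_mul, mul_comm]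
  rfl

include hF in
/-- `j(x) ∈ Fil¹ B_dR` forces `x ∈ Fil¹ B_dR⁺` (`j` injective, `Fil¹ B_dR = j(ξ B_dR⁺)`). [cite: FontaineAsterisque223III, Exp. II §1.5.5] -/
theorem mem_filOne_of_bdRPlusToFrac_mem_fil_one [Algebra ℚ_[p] F] {x : BdRPlusTop F p}
    (hx : bdRPlusToFrac hp ((of F p).symm x) ∈ (bdRPeriodRingData (F := F) (p := p) hp).fil 1) : x ∈ (filOne F p).toIdeal := by
  haveI : IsDomain (BDeRhamPlus (integerC F) p) := isDomain_bDeRhamPlus hF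
  obtain ⟨b, hb⟩ := (mem_fil_iff hp (surjective_fontaineTheta_integerC hp)).1 hx
  rw [zpow_one, ← map_mul] at hb
  rw [mem_filOne_iff, bdRPlusToFrac_injective hp hb]
  exact Ideal.mem_span_singleton'.2 ⟨b, mul_comm _ _⟩

include hgal in
/-- ★★ **The Legendre relation up to `F^×`.** Let `Pω, Pη : T_pW → B_dR⁺(F)` be additive, `ℤ_p`-homogeneous and `Γ_F`-equivariant with
`Pω ⊆ Fil¹`, `Pω(a₁) ≠ 0` and `Pη(a₂) ∉ Fil¹` for some `a₁, a₂`; let the Weil tower `e_∞` be `ℤ_p`-homogeneous on the left, alternating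
and non-degenerate on `T_pW`. Then **`Pω(S)Pη(U) − Pη(S)Pω(U) = ι_F(c) · ι(e_∞(S,U))` for some `c ∈ F`, `c ≠ 0`, and all `S, U`.**
[cite: Colmez1992PeriodesAbeliennes, §2] [cite: Fontaine1982FormesDifferentielles, §5] [cite: Tate1967, §4 Cor. 2] -/
theorem exists_legendre_of_periodHoms {Pω Pη : W.tateModule p →+ BdRPlusTop F p}
    (hPωZ : ∀ (c : ℤ_[p]) (a : W.tateModule p), Pω (c • a) = of F p (qpToBdR (c : ℚ_[p])) * Pω a)
    (hPηZ : ∀ (c : ℤ_[p]) (a : W.tateModule p), Pη (c • a) = of F p (qpToBdR (c : ℚ_[p])) * Pη a)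
    (hPω : ∀ (σ : absoluteGaloisGroup F) (a : W.tateModule p), gal F p σ (Pω a) = Pω (restrictedTateRep W F p σ a))
    (hPη : ∀ (σ : absoluteGaloisGroup F) (a : W.tateModule p), gal F p σ (Pη a) = Pη (restrictedTateRep W F p σ a))
    (hfil : ∀ a, Pω a ∈ (filOne F p).toIdeal) (hne : ∃ a, Pω a ≠ 0) (hnot : ∃ a, Pη a ∉ (filOne F p).toIdeal)
    (heL : ∀ (c : ℤ_[p]) (S U : W.tateModule p), (weilContPairingPadic W F p e hμ hadd₁ hadd₂ hgal hcompat).toLin (c • S) U =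
      twistHom F p ((weilContPairingPadic W F p e hμ hadd₁ hadd₂ hgal hcompat).toLin S U) c)
    (healt : ∀ S : W.tateModule p, (weilContPairingPadic W F p e hμ hadd₁ hadd₂ hgal hcompat).toLin S S = 0)
    (henondeg : ∀ S : W.tateModule p, (∀ U, (weilContPairingPadic W F p e hμ hadd₁ hadd₂ hgal hcompat).toLin S U = 0) → S = 0) :
    ∃ c : F, c ≠ 0 ∧ ∀ S U : W.tateModule p, Pω S * Pη U - Pη S * Pω U =
      of F p (embBdRHom hp hF c) * periodLine F p ((weilContPairingPadic W F p e hμ hadd₁ hadd₂ hgal hcompat).toLin S U) := by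
  classical
  letI : Algebra ℚ_[p] F := LocalField.padicAlgebra F p hp
  have halg : ∀ c : ℚ_[p], algebraMap ℚ_[p] F c = LocalField.padicRingHom F p hp c := fun _ => rfl
  haveI : IsDomain (BDeRhamPlus (integerC F) p) := isDomain_bDeRhamPlus hF
  have hpK : (p : K₀) ≠ 0 := Nat.cast_ne_zero.mpr (Fact.out : p.Prime).ne_zero
  haveI := module_free_tateModule_holds W p
  haveI := module_finite_tateModule_holds W p
  -- a `ℤ_p`-basis `b` of `T_pW` and the `ℚ_p`-basis `1 ⊗ b` of `V_pW`
  let b : Module.Basis (Fin 2) ℤ_[p] (W.tateModule p) := Module.finBasisOfFinrankEq ℤ_[p] _ (finrank_tateModule_eq_two_holds W p hpK)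
  let v : Module.Basis (Fin 2) ℚ_[p] (W.rationalTateModule p) := Algebra.TensorProduct.basis ℚ_[p] b
  have hv : ∀ i, v i = TateModule.toRational p (b i) := fun i => by
    rw [TateModule.toRational_apply]; exact Algebra.TensorProduct.basis_apply b i
  -- the period maps read in `B_dR` and their equivariant extensions
  set φ₁ : W.tateModule p →+ (bdRPeriodRingData (F := F) (p := p) hp).B :=
    (bdRPlusToFrac hp).toAddMonoidHom.comp (((of F p).symm : BdRPlusTop F p ≃+* BDeRhamPlus (integerC F) p).toAddMonoidHom.comp Pω)
    with hφ₁def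
  set φ₂ : W.tateModule p →+ (bdRPeriodRingData (F := F) (p := p) hp).B :=
    (bdRPlusToFrac hp).toAddMonoidHom.comp (((of F p).symm : BdRPlusTop F p ≃+* BDeRhamPlus (integerC F) p).toAddMonoidHom.comp Pη)
    with hφ₂def
  have hφ₁app : ∀ a, φ₁ a = bdRPlusToFrac hp ((of F p).symm (Pω a)) := fun a => rfl
  have hφ₂app : ∀ a, φ₂ a = bdRPlusToFrac hp ((of F p).symm (Pη a)) := fun a => rfl
  have hZ : ∀ (P : W.tateModule p →+ BdRPlusTop F p), (∀ (c : ℤ_[p]) a, P (c • a) = of F p (qpToBdR (c : ℚ_[p])) * P a) →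
      ∀ (c : ℤ_[p]) (a : W.tateModule p), bdRPlusToFrac hp ((of F p).symm (P (c • a))) =
        (c : ℚ_[p]) • bdRPlusToFrac hp ((of F p).symm (P a)) := fun P hP c a => by
    rw [hP, map_mul, RingEquiv.symm_apply_apply, map_mul, bdRPlusToFrac_qpToBdR hp halg, Algebra.smul_def]
  have hσ : ∀ (P : W.tateModule p →+ BdRPlusTop F p), (∀ σ a, gal F p σ (P a) = P (restrictedTateRep W F p σ a)) →
      ∀ (σ : absoluteGaloisGroup F) (a : W.tateModule p), bdRPlusToFrac hp ((of F p).symm (P (absGaloisRestrict K₀ F σ • a))) =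
        σ • bdRPlusToFrac hp ((of F p).symm (P a)) := fun P hP σ a => by
    rw [← restrictedTateRep_apply_apply, ← hP, ← bdRPlusToFrac_galBdRPlus]; rfl
  obtain ⟨Φ₁, hΦ₁, hΦ₁σ⟩ := exists_equivariant_extend_rationalTateModule (bdRPeriodRingData (F := F) (p := p) hp)
    (restrictedRationalTateRep W F p) (fun σ a => absGaloisRestrict K₀ F σ • a) (fun _ _ _ => rfl) φ₁ (hZ Pω hPωZ) (hσ Pω hPω)
  obtain ⟨Φ₂, hΦ₂, hΦ₂σ⟩ := exists_equivariant_extend_rationalTateModule (bdRPeriodRingData (F := F) (p := p) hp)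
    (restrictedRationalTateRep W F p) (fun σ a => absGaloisRestrict K₀ F σ • a) (fun _ _ _ => rfl) φ₂ (hZ Pη hPηZ) (hσ Pη hPη)
  -- the period determinant on the basis is `c₁ · t`
  obtain ⟨a₁, ha₁⟩ := hne
  obtain ⟨a₂, ha₂⟩ := hnot
  obtain ⟨c₁, hc₁, hdet⟩ := exists_det_eq_algebraMap_mul_tFrac hp (restrictedRationalTateRep W F p) v
    (det_restrictedRationalTateRep_eq_cyclotomicCharacter (F := F) (p := p) W) halg Φ₁ Φ₂ hΦ₁σ hΦ₂σ
    (apply_mem_of_forall_toRational_mem _ Φ₁ _ fun a => by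
      rw [hΦ₁, hφ₁app]; exact bdRPlusToFrac_mem_fil_one_of_mem_filOne hp hF (hfil a))
    ⟨TateModule.toRational p a₁, by
      rw [hΦ₁, hφ₁app, Ne, map_eq_zero_iff _ (bdRPlusToFrac_injective hp), map_eq_zero_iff _ (of F p).symm.injective]
      exact ha₁⟩
    ⟨TateModule.toRational p a₂, by
      rw [hΦ₂, hφ₂app]; exact fun h => ha₂ (mem_filOne_of_bdRPlusToFrac_mem_fil_one hp hF h)⟩
  rw [hv 0, hv 1, hΦ₁, hΦ₁, hΦ₂, hΦ₂, hφ₁app, hφ₁app, hφ₂app, hφ₂app] at hdet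
  have hΔb : Pω (b 0) * Pη (b 1) - Pη (b 0) * Pω (b 1) = of F p (embBdRHom hp hF c₁) * of F p tBdR := by
    apply (of F p).symm.injective
    apply bdRPlusToFrac_injective hp
    rw [map_sub, map_mul, map_mul, map_sub, map_mul, map_mul, mul_comm ((bdRPlusToFrac hp) ((of F p).symm (Pη (b 0)))), hdet, map_mul,
      map_mul, RingEquiv.symm_apply_apply, RingEquiv.symm_apply_apply]
    rfl
  -- the Weil pairing on the basis is `a₀ · t`, `a₀ ≠ 0`
  set a₀ : ℤ_[p] := (epsLineEquiv F p).symm ((weilContPairingPadic W F p e hμ hadd₁ hadd₂ hgal hcompat).toLin (b 0) (b 1)) with ha₀def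
  have hGb : periodLine F p ((weilContPairingPadic W F p e hμ hadd₁ hadd₂ hgal hcompat).toLin (b 0) (b 1)) =
      of F p (qpToBdR (a₀ : ℚ_[p])) * of F p tBdR := by
    rw [periodLine_apply, map_mul]
  have heR : ∀ (c : ℤ_[p]) (S U : W.tateModule p), (weilContPairingPadic W F p e hμ hadd₁ hadd₂ hgal hcompat).toLin S (c • U) =
      twistHom F p ((weilContPairingPadic W F p e hμ hadd₁ hadd₂ hgal hcompat).toLin S U) c := fun c S U => by
    rw [weilContPairingPadic_toLin_apply, weilContPairingPadic_toLin_apply]; exact weilPairingPadicHom_smul_right W e hμ hadd₁ hadd₂ hcompat S U c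
  have ha₀ : a₀ ≠ 0 := by
    intro h0
    have he01 : (weilContPairingPadic W F p e hμ hadd₁ hadd₂ hgal hcompat).toLin (b 0) (b 1) = 0 := by
      rw [← (epsLineEquiv F p).apply_symm_apply ((weilContPairingPadic W F p e hμ hadd₁ hadd₂ hgal hcompat).toLin (b 0) (b 1)),
        ← ha₀def, h0, map_zero]
    have htw0 : ∀ a : ℤ_[p], twistHom F p (0 : (muPadicSystem F p).limit) a = 0 := fun a => by
      rw [← map_zero (epsLineEquiv F p), epsLineEquiv_apply, twistHom_twistHom, zero_mul]
    refine b.ne_zero 0 (henondeg (b 0) fun U => ?_)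
    have hU : U = b.repr U 0 • b 0 + b.repr U 1 • b 1 := by
      conv_lhs => rw [← b.sum_repr U]
      rw [Fin.sum_univ_two]
    rw [hU, map_add, heR, heR, healt, he01, htw0, htw0, add_zero]
  -- the two alternating forms, bundled
  let Δ : W.tateModule p →+ W.tateModule p →+ BdRPlusTop F p :=
    AddMonoidHom.mk' (fun S => AddMonoidHom.mk' (fun U => Pω S * Pη U - Pη S * Pω U) fun U U' => by
      simp only [map_add]; ring) fun S S' => by
      ext U; simp only [AddMonoidHom.mk'_apply, AddMonoidHom.add_apply, map_add]; ring
  have hΔ : ∀ S U, Δ S U = Pω S * Pη U - Pη S * Pω U := fun _ _ => rfl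
  let G : W.tateModule p →+ W.tateModule p →+ BdRPlusTop F p :=
    AddMonoidHom.mk' (fun S => (periodLine F p).comp ((weilContPairingPadic W F p e hμ hadd₁ hadd₂ hgal hcompat).toLin S).toAddMonoidHom)
      fun S S' => by ext U; simp only [AddMonoidHom.coe_comp, Function.comp_apply, LinearMap.toAddMonoidHom_coe, map_add,
        LinearMap.add_apply, AddMonoidHom.add_apply]
  have hG : ∀ S U, G S U = periodLine F p ((weilContPairingPadic W F p e hμ hadd₁ hadd₂ hgal hcompat).toLin S U) := fun _ _ => rfl
  have key := exists_legendre_of_basis_values hp hF b Δ G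
    (fun c x y => by rw [hΔ, hΔ, hPωZ, hPηZ]; ring) (fun c x y => by rw [hΔ, hΔ, hPωZ, hPηZ]; ring) (fun x => by rw [hΔ]; ring)
    (fun c x y => by rw [hG, hG, heL, periodLine_twistHom]) (fun c x y => by rw [hG, hG, heR, periodLine_twistHom])
    (fun x => by rw [hG, healt, map_zero]) (by rw [hΔ]; exact hΔb) ha₀ (by rw [hG]; exact hGb)
  refine ⟨c₁ * (LocalField.padicRingHom F p hp (a₀ : ℚ_[p]))⁻¹, mul_ne_zero hc₁ (inv_ne_zero
    ((map_ne_zero_iff _ (LocalField.padicRingHom F p hp).injective).2 (PadicInt.coe_ne_zero.2 ha₀))), fun S U => ?_⟩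
  rw [← hΔ, ← hG]
  exact key S U

end BdRPlusTop

end Literature.NumberTheory.PAdicHodge

end
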